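import Literature.NumberTheory.QuadraticFields.DedekindZetaReducedForms
import Literature.NumberTheory.QuadraticFields.QuadraticDedekindZeta
import Literature.NumberTheory.QuadraticFields.FundamentalDiscriminant
import Literature.NumberTheory.QuadraticFields.ClassNumberOneBakerInequality
import Literature.NumberTheory.QuadraticFields.EpsteinZetaKroneckerLimitExact
import Mathlib.NumberTheory.Harmonic.ZetaAsymp
import HarnessLib

/-!
# Chowla–Selberg at `D = −15`, I: `Z₁ + Z₂ = 2ζ(s)L(s, χ₋₁₅)` and the sum of the two
# Kronecker-limit constants

Topic `NumberTheory/QuadraticFields`, namespace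
`Literature.NumberTheory.QuadraticFields.ChowlaSelbergFifteen` (companion of
`EpsteinZetaFifteenSublattices.lean`). Everything here is PROVED (theorems only; no definitions,
no named facts).

`ℚ(√−15)` has discriminant `−15`, class number `2`, `w = 2`, and reduced forms
`Q₁ = x² + xy + 4y²`, `Q₂ = 2x² + xy + 2y²` (`reducedForms_neg_fifteen`, by evaluation). With
`Z_j = Z_{Q_j}` the tree's Epstein zeta functions and `χ = χ₋₁₅ = (·/15)` (`jacobiChar 15`):

* `epsteinZeta_add_eq` — **`Z₁(s) + Z₂(s) = 2 ζ(s) L(s, χ)`** for `Re s > 1` (Dirichlet: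
  `ζ_K = ½ Σ_Q Z_Q`, tree `dedekindZeta_eq_half_sum_epsteinZeta`, and `ζ_K = ζ · L(χ_{d_K})`, tree
  `dedekindZeta_eq_riemannZeta_mul_LSeries`, for a quadratic field `K` with `d_K = −15`, which
  exists by `exists_numberField_discr_eq`);
* `LFunction_chi_one` — **`L(1, χ) = 2π/√15`** (Dirichlet's class number formula, tree
  `LFunction_jacobiChar_one_eq_of_discr_neg`, with `h_K = h(−15) = 2` and `w_K = 2`);
* `kroneckerConstant_add` — **the sum of the Kronecker-limit constants**: with
  `C_j = lim_{s→1⁺} (Z_j(s) − (2π/√15)/(s−1)) = (2π/√15)(2γ − log(15/a_j) − 4 log|η(τ_j)|)`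
  (tree `KroneckerLimit.tendsto_epsteinZeta_sub_pole_eta`; `τ₁ = (1+i√15)/2`, `τ₂ = (1+i√15)/4`),
  `C₁ + C₂ = 2(γ L(1, χ) + L′(1, χ))`, because `Z₁ + Z₂ − 2L(1,χ)/(s−1)
  = 2[(ζ(s) − 1/(s−1)) L(s,χ) + (L(s,χ) − L(1,χ))/(s−1)] → 2(γL(1,χ) + L′(1,χ))` (Mathlib's
  `ζ(s) − 1/(s−1) → γ` and the differentiability of `L(s, χ)` at `1`).

This is the "sum" half of the classical derivation of the Chowla–Selberg formula (Selberg–Chowla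
1967, §2; Siegel's lectures, Ch. II §4: compare the constant terms at `s = 1` of
`Σ_Q Z_Q = w ζ L`), specialised to `D = −15`; the "difference" half (genus character,
`Z₁ − Z₂ = 2L(s,χ₋₃)L(s,χ₅)`) and `L′(1, χ₋₁₅)` through Lerch's formula are in the sequels.

## References

* A. Selberg, S. Chowla, On Epstein's zeta-function, J. reine angew. Math. 227 (1967) 86–110, §2.
* [BorweinBorwein1987] J. M. Borwein, P. B. Borwein, *Pi and the AGM* (1987), §9.2 (singular values
  from Kronecker's limit formula).
* [Cox2013] D. A. Cox, *Primes of the form x² + ny²*, 2nd ed. (2013), §2.A (the reduced forms of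
  discriminant `−15`), §7.B Thm. 7.7.
-/

noncomputable section

open Complex Filter Topology Module NumberField NumberField.Units
open Literature.Barriers.RiemannHypothesis
open Literature.NumberTheory.QuadraticFields.Quadratic
open Literature.NumberTheory.QuadraticFields.BakerLimitFormula (torsionOrder_eq_two)
open Literature.NumberTheory.QuadraticFields.KroneckerLimit
open Literature.NumberTheory.QuadraticFields.BinaryQuadraticForm (reducedForms)

namespace Literature.NumberTheory.QuadraticFields.ChowlaSelbergFifteen

/-! ### The discriminant `−15`: reduced forms and the field -/

/-- `−15` is a fundamental discriminant (`−15 ≡ 1 (mod 4)`, square-free). [folklore] -/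
theorem isFundamental_neg_fifteen :
    ((-15 : ℤ) % 4 = 1 ∧ Squarefree (-15 : ℤ) ∧ (-15 : ℤ) ≠ 1) ∨
      (4 ∣ (-15 : ℤ) ∧ ((-15 : ℤ) / 4 % 4 = 2 ∨ (-15 : ℤ) / 4 % 4 = 3) ∧ Squarefree ((-15 : ℤ) / 4)) := by
  refine Or.inl ⟨by norm_num, ?_, by norm_num⟩
  rw [← Int.squarefree_natAbs]
  show Squarefree (15 : ℕ)
  rw [show (15 : ℕ) = 3 * 5 by norm_num, Nat.squarefree_mul (by norm_num)]
  exact ⟨Nat.prime_three.squarefree, Nat.prime_five.squarefree⟩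

/-- **The reduced forms of discriminant `−15` are `x² + xy + 4y²` and `2x² + xy + 2y²`**
(`h(−15) = 2`; Cox §2.A), by evaluation of the tree's `reducedForms`. [cite: Cox2013, §2.A Thm. 2.13] -/
theorem reducedForms_neg_fifteen :
    reducedForms (-15) = {((1 : ℤ), (1 : ℤ), (4 : ℤ)), (2, 1, 2)} := by
  decide

/-- There is a quadratic field of discriminant `−15`. [folklore] -/
theorem exists_quadraticField_neg_fifteen :
    ∃ (K : Type) (_ : Field K) (_ : NumberField K), finrank ℚ K = 2 ∧ NumberField.discr K = -15 :=
  exists_numberField_discr_eq isFundamental_neg_fifteen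

section Field

variable {K : Type*} [Field K] [NumberField K]

/-- For `d_K = −15`: `ζ_K(s) = ½ (Z₁(s) + Z₂(s))` (`Re s > 1`). [cite: Cox2013, §7.B Thm. 7.7] -/
theorem dedekindZeta_eq_half_add (h2 : finrank ℚ K = 2) (hd : NumberField.discr K = -15)
    {s : ℂ} (hs : 1 < s.re) :
    NumberField.dedekindZeta K s = 1 / 2 * (epsteinZeta 1 1 4 s + epsteinZeta 2 1 2 s) := by
  rw [dedekindZeta_eq_half_sum_epsteinZeta h2 (by rw [hd]; norm_num) hs, hd, reducedForms_neg_fifteen,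
    Finset.sum_pair (by decide)]
  push_cast
  ring

/-- For `d_K = −15`: `ζ_K(s) = ζ(s) L(s, χ₋₁₅)` (`Re s > 1`), `χ₋₁₅ = jacobiChar 15`.
[cite: Cox2013, §7.B Thm. 7.7] -/
theorem dedekindZeta_eq_zeta_mul (h2 : finrank ℚ K = 2) (hd : NumberField.discr K = -15)
    {s : ℂ} (hs : 1 < s.re) :
    NumberField.dedekindZeta K s = riemannZeta s * LSeries (fun n => jacobiChar 15 n) s := by
  have hodd : Odd (NumberField.discr K) := by rw [hd]; decide
  have h := dedekindZeta_eq_riemannZeta_mul_LSeries h2 hodd hs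
  have h15 : (NumberField.discr K).natAbs = 15 := by rw [hd]; rfl
  haveI : NeZero (NumberField.discr K).natAbs := neZero_natAbs_discr
  have hcongr : ∀ (N : ℕ) [NeZero N], N = 15 → ∀ n : ℕ, jacobiChar N n = jacobiChar 15 n := by
    intro N _ hN n; subst hN; rfl
  rw [h]
  congr 1
  exact LSeries_congr (fun {n} _ => hcongr _ h15 n) s

/-- For `d_K = −15`: `h_K = 2`. [cite: Cox2013, §7.B Thm. 7.7] -/
theorem classNumber_eq_two (h2 : finrank ℚ K = 2) (hd : NumberField.discr K = -15) :
    NumberField.classNumber K = 2 := by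
  have h := card_reducedForms_eq_classNumber h2 (by rw [hd]; norm_num)
  rw [hd, BinaryQuadraticForm.classNumber, reducedForms_neg_fifteen] at h
  rw [← h]
  decide

/-- For `d_K = −15`: `w_K = 2`. [cite: Cox2013, §7.A] -/
theorem torsionOrder_eq_two' (h2 : finrank ℚ K = 2) (hd : NumberField.discr K = -15) :
    torsionOrder K = 2 := by
  obtain ⟨b, hb⟩ := exists_basis_zero_eq_one h2
  have hω := basis_one_mul_self_eq b hb
  have hDK := discr_eq_sq_add_four_mul b hb
  exact torsionOrder_eq_two b hb hω (by rw [← hDK, hd]; norm_num)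

/-- For `d_K = −15`: `L(1, χ₋₁₅) = 2π/√15` (Dirichlet's class number formula with `h = 2`, `w = 2`).
[cite: Cox2013, §7.B Thm. 7.7] -/
theorem LFunction_chi_one_of_field (h2 : finrank ℚ K = 2) (hd : NumberField.discr K = -15) :
    (jacobiChar 15).LFunction 1 = ((2 * Real.pi / Real.sqrt 15 : ℝ) : ℂ) := by
  have hodd : Odd (NumberField.discr K) := by rw [hd]; decide
  have hneg : NumberField.discr K < 0 := by rw [hd]; norm_num
  have h := LFunction_jacobiChar_one_eq_of_discr_neg h2 hodd hneg
  have h15 : (NumberField.discr K).natAbs = 15 := by rw [hd]; rfl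
  haveI : NeZero (NumberField.discr K).natAbs := neZero_natAbs_discr
  have hcongr : ∀ (N : ℕ) [NeZero N], N = 15 → (jacobiChar N).LFunction 1 = (jacobiChar 15).LFunction 1 := by
    intro N _ hN; subst hN; rfl
  have hchar : (jacobiChar (NumberField.discr K).natAbs).LFunction 1 = (jacobiChar 15).LFunction 1 :=
    hcongr _ h15
  rw [hchar, classNumber_eq_two h2 hd, torsionOrder_eq_two' h2 hd] at h
  rw [h, hd]
  congr 1
  push_cast
  rw [show |(-15 : ℝ)| = 15 by norm_num]
  ring

end Field

/-! ### `Z₁ + Z₂ = 2 ζ L(χ₋₁₅)` and `L(1, χ₋₁₅) = 2π/√15` -/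

/-- **`Z₁(s) + Z₂(s) = 2 ζ(s) L(s, χ₋₁₅)` for `Re s > 1`** (Dirichlet, class by class; `w = 2`).
[cite: Cox2013, §7.B Thm. 7.7] -/
theorem epsteinZeta_add_eq {s : ℂ} (hs : 1 < s.re) :
    epsteinZeta 1 1 4 s + epsteinZeta 2 1 2 s =
      2 * (riemannZeta s * LSeries (fun n => jacobiChar 15 n) s) := by
  obtain ⟨K, _, _, h2, hd⟩ := exists_quadraticField_neg_fifteen
  have h1 := dedekindZeta_eq_half_add h2 hd hs
  have h2' := dedekindZeta_eq_zeta_mul h2 hd hs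
  rw [h1] at h2'
  linear_combination 2 * h2'

/-- **`L(1, χ₋₁₅) = 2π/√15`.** [cite: Cox2013, §7.B Thm. 7.7] -/
theorem LFunction_chi_one : (jacobiChar 15).LFunction 1 = ((2 * Real.pi / Real.sqrt 15 : ℝ) : ℂ) := by
  obtain ⟨K, _, _, h2, hd⟩ := exists_quadraticField_neg_fifteen
  exact LFunction_chi_one_of_field h2 hd

/-- `χ₋₁₅ ≠ 1`. [folklore] -/
theorem jacobiChar_fifteen_ne_one : jacobiChar 15 ≠ 1 :=
  jacobiChar_ne_one (by decide) (by
    rw [show (15 : ℕ) = 3 * 5 by norm_num, Nat.squarefree_mul (by norm_num)]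
    exact ⟨Nat.prime_three.squarefree, Nat.prime_five.squarefree⟩) (by norm_num)

/-! ### The sum of the two Kronecker-limit constants -/

/-- `x² + xy + 4y²` is positive definite. [folklore] -/
private theorem isPosDefForm_Q₁' : IsPosDefForm 1 1 4 := ⟨by norm_num, by norm_num⟩

/-- `2x² + xy + 2y²` is positive definite. [folklore] -/
private theorem isPosDefForm_Q₂' : IsPosDefForm 2 1 2 := ⟨by norm_num, by norm_num⟩

/-- The Kronecker-limit constant of `Q₁ = x² + xy + 4y²`:
`Z₁(s) − (2π/√15)/(s−1) → (2π/√15)(2γ − log 15 − 4 log|η(τ₁)|)`, `τ₁ = (1 + i√15)/2`.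
[cite: BorweinBorwein1987, §9.2] -/
theorem tendsto_Z₁ :
    Tendsto (fun s : ℝ => epsteinZeta 1 1 4 s - ((2 * Real.pi / Real.sqrt 15 : ℝ) : ℂ) / ((s : ℂ) - 1))
      (𝓝[>] 1)
      (𝓝 ((2 * Real.pi / Real.sqrt 15 * (2 * Real.eulerMascheroniConstant - Real.log 15 -
        4 * Real.log ‖ModularForm.eta (rootPoint 1 1 4)‖) : ℝ) : ℂ)) := by
  have h := tendsto_epsteinZeta_sub_pole_eta isPosDefForm_Q₁'
  convert h using 4 <;> norm_num

/-- The Kronecker-limit constant of `Q₂ = 2x² + xy + 2y²`: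
`Z₂(s) − (2π/√15)/(s−1) → (2π/√15)(2γ − log(15/2) − 4 log|η(τ₂)|)`, `τ₂ = (1 + i√15)/4`.
[cite: BorweinBorwein1987, §9.2] -/
theorem tendsto_Z₂ :
    Tendsto (fun s : ℝ => epsteinZeta 2 1 2 s - ((2 * Real.pi / Real.sqrt 15 : ℝ) : ℂ) / ((s : ℂ) - 1))
      (𝓝[>] 1)
      (𝓝 ((2 * Real.pi / Real.sqrt 15 * (2 * Real.eulerMascheroniConstant - Real.log (15 / 2) -
        4 * Real.log ‖ModularForm.eta (rootPoint 2 1 2)‖) : ℝ) : ℂ)) := by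
  have h := tendsto_epsteinZeta_sub_pole_eta isPosDefForm_Q₂'
  convert h using 4 <;> norm_num

/-- **`C₁ + C₂ = 2(γ L(1,χ₋₁₅) + L′(1,χ₋₁₅))`**: the sum of the Kronecker-limit constants of the two
reduced forms of discriminant `−15` is the constant term of `2ζ(s)L(s,χ₋₁₅)` at `s = 1`
(`Z₁ + Z₂ = 2ζL`, `L(1,χ) = 2π/√15`, `ζ(s) = 1/(s−1) + γ + o(1)`).
[cite: BorweinBorwein1987, §9.2] -/
theorem kroneckerConstant_add :
    ((2 * Real.pi / Real.sqrt 15 * (2 * Real.eulerMascheroniConstant - Real.log 15 -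
        4 * Real.log ‖ModularForm.eta (rootPoint 1 1 4)‖) : ℝ) : ℂ) +
      ((2 * Real.pi / Real.sqrt 15 * (2 * Real.eulerMascheroniConstant - Real.log (15 / 2) -
        4 * Real.log ‖ModularForm.eta (rootPoint 2 1 2)‖) : ℝ) : ℂ) =
      2 * ((Real.eulerMascheroniConstant : ℂ) * (jacobiChar 15).LFunction 1 +
        deriv (jacobiChar 15).LFunction 1) := by
  set χ := jacobiChar 15 with hχdef
  set L := χ.LFunction with hL
  set P : ℝ := 2 * Real.pi / Real.sqrt 15 with hP
  have hL1 : L 1 = (P : ℂ) := LFunction_chi_one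
  have hχ : χ ≠ 1 := jacobiChar_fifteen_ne_one
  -- the function `F(s) = Z₁ + Z₂ − 2P/(s−1)` and its two limits
  set F : ℝ → ℂ := fun s => epsteinZeta 1 1 4 s + epsteinZeta 2 1 2 s - 2 * (P : ℂ) / ((s : ℂ) - 1)
    with hF
  -- (E) Epstein side
  have hE : Tendsto F (𝓝[>] 1) (𝓝 ((((P * (2 * Real.eulerMascheroniConstant - Real.log 15 -
        4 * Real.log ‖ModularForm.eta (rootPoint 1 1 4)‖) : ℝ)) : ℂ) +
      (((P * (2 * Real.eulerMascheroniConstant - Real.log (15 / 2) -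
        4 * Real.log ‖ModularForm.eta (rootPoint 2 1 2)‖) : ℝ)) : ℂ))) := by
    refine (tendsto_Z₁.add tendsto_Z₂).congr fun s => ?_
    simp only [hF, hP]
    ring
  -- (L) L-function side
  have hζ : Tendsto (fun s : ℝ => riemannZeta s - 1 / ((s : ℂ) - 1)) (𝓝[>] 1)
      (𝓝 (Real.eulerMascheroniConstant : ℂ)) :=
    tendsto_riemannZeta_sub_one_div.comp tendsto_ofReal_nhdsGT_one
  have hLc : Tendsto (fun s : ℝ => L s) (𝓝[>] 1) (𝓝 (L 1)) := by
    have hc : Continuous L := (DirichletCharacter.differentiable_LFunction hχ).continuous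
    exact (hc.tendsto (1 : ℂ)).comp
      ((Complex.continuous_ofReal.tendsto (1 : ℝ)).mono_left (nhdsWithin_le_nhds (s := Set.Ioi 1)))
  have hslope : Tendsto (fun s : ℝ => (L s - L 1) / ((s : ℂ) - 1)) (𝓝[>] 1) (𝓝 (deriv L 1)) := by
    have hd : HasDerivAt L (deriv L 1) 1 :=
      ((DirichletCharacter.differentiable_LFunction hχ) 1).hasDerivAt
    have ht := (hasDerivAt_iff_tendsto_slope.mp hd).comp tendsto_ofReal_nhdsGT_one
    refine ht.congr fun s => ?_
    simp only [Function.comp_apply, slope_def_field]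
  have hLside : Tendsto F (𝓝[>] 1)
      (𝓝 (2 * ((Real.eulerMascheroniConstant : ℂ) * L 1 + deriv L 1))) := by
    have hlim := ((hζ.mul hLc).add hslope).const_mul 2
    refine hlim.congr' ?_
    filter_upwards [self_mem_nhdsWithin] with s hs
    have hs' : 1 < (s : ℂ).re := by simpa using hs
    have hs1 : (s : ℂ) - 1 ≠ 0 := by
      rw [sub_ne_zero]
      exact_mod_cast (ne_of_gt hs)
    have hsum := epsteinZeta_add_eq hs'
    rw [← DirichletCharacter.LFunction_eq_LSeries χ hs'] at hsum
    simp only [hF]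
    rw [hsum, ← hL, hL1]
    field_simp
    ring
  have := tendsto_nhds_unique hE hLside
  simpa [hP] using this

end Literature.NumberTheory.QuadraticFields.ChowlaSelbergFifteen
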